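import Summits.HodgeConjecture.CorCM.TwoGroupFrattiniInvolution
import Summits.HodgeConjecture.CorCM.GaloisSixteenTableLawsA
import HarnessLib

/-!
# The extraspecial configuration `⟨x, y⟩ ∘ ⟨x', y'⟩` of order `32`: generators and a table model on `𝔽₂⁵`

COR-CM (cell `pub-hodgecm2`), binder seat b04 (gen 36), count-neutral own lane «Galois-CM-type classification».  KERNEL ONLY,
pure group theory: theorems; no definition, no named fact, no `sorry`.  Sequel of `CorCM/TwoGroupFrattiniInvolution` (groups with
every square in `{1, c}`, `c` a central involution): the case where the centralizer `C_G(x)` of a non-commuting pair `x, y`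
(`y x = x y c`) is NOT abelian.

* `exists_noncomm_pair_centralizing` — there are `x', y'` commuting with `x` and `y` with `y' x' = x' y' c`.
* `exists_noncomm_pair_normalised` — a non-commuting pair can be put in the shape `x² = y²` (`= 1`: dihedral type; `= c`:
  quaternion type) without leaving the subgroup it generates.
* `pair_words_mul` — the multiplication of the words `xᵃ yᵇ` (`a, b ∈ 𝔽₂`): `(xᵃyᵇ)(xᵉyᶠ) = x^{a+e} y^{b+f} c^{be + α ae + β bf}`
  for `x² = c^α`, `y² = c^β`.
* **`exists_table_extraspecial`** — for `|G| = 32` the word map `(a,b,a',b',z) ↦ xᵃ yᵇ x'ᵃ' y'ᵇ' cᶻ` inverts to a TABLE MODEL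
  `e : G ≃ 𝔽₂⁵` of the law
  `(a,b,a',b',z)·(e,f,e',f',w) = (a+e, b+f, a'+e', b'+f', z + w + (be + α ae + β bf) + (b'e' + α' a'e' + β' b'f'))`
  with `e x = (1,0,0,0,0)`, …, `e c = (0,0,0,0,1)`, `e 1 = 0` (parameters `α, β, α', β' ∈ 𝔽₂` = the squares of the generators;
  `(α,β,α',β') = (0,0,0,0), (1,1,1,1)`: `2^{1+4}_+ = D₄ ∘ D₄ ≅ Q₈ ∘ Q₈`; `(0,0,1,1)`: `2^{1+4}_- = D₄ ∘ Q₈`).  The unit and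
  left-inverse identities of the law are hypotheses (`decide`d at concrete parameters by the user,
  `CorCM/GaloisThirtyTwoFrattiniDegenerate`); `exists_table_equiv_of_words_inv` is the corresponding recognition lemma.

## References

* [Rotman1995] J. J. Rotman, *An Introduction to the Theory of Groups*, 4th ed., GTM 148, Springer 1995, Ex. 5.43, Thm. 5.46
  (extraspecial `2`-groups; context).
* [Dodson1984] B. Dodson, *The structure of Galois groups of CM-fields*, Trans. AMS 283 (1984), §5.3 (context).
-/

namespace Summit.HodgeConjecture.CorCM.GaloisModels.FrattiniTwo

open Summit.HodgeConjecture.CorCM.GaloisTableLaws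

variable {G : Type*} [Group G]

/-! ## §4 The extraspecial configuration (the case `C_G(x)` non-abelian) -/

/-- **A second non-commuting pair centralizing the first**: if `C_G(x)` is not abelian, there are `x', y'` commuting with `x` and
`y` with `y' x' = x' y' c`. [folklore] -/
theorem exists_noncomm_pair_centralizing {c : G} (hcc : c * c = 1) (hcen : ∀ g : G, c * g = g * c)
    (hsq : ∀ g : G, g * g = 1 ∨ g * g = c) {x y : G} (hyx : y * x = x * y * c)
    (hnab : ∃ g ∈ Subgroup.centralizer ({x} : Set G), ∃ h ∈ Subgroup.centralizer ({x} : Set G), g * h ≠ h * g) :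
    ∃ x' y' : G, x' * x = x * x' ∧ x' * y = y * x' ∧ y' * x = x * y' ∧ y' * y = y * y' ∧ y' * x' = x' * y' * c := by
  obtain ⟨g, hg, h, hh, hgh⟩ := hnab
  have hgx : g * x = x * g := Subgroup.mem_centralizer_singleton_iff.1 hg
  have hhx : h * x = x * h := Subgroup.mem_centralizer_singleton_iff.1 hh
  have hxy : x * y = y * x * c := comm_mul_symm hcc hyx
  -- correct `g`, `h` by `x` so that they commute with `y`
  have hfix : ∀ k : G, k * x = x * k → ∃ k' : G, (k' = k ∨ k' = k * x) ∧ k' * x = x * k' ∧ k' * y = y * k' := by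
    intro k hkx
    rcases comm_or_comm_mul hcc hcen hsq y k with hky | hky
    · exact ⟨k, Or.inl rfl, hkx, hky⟩
    · refine ⟨k * x, Or.inr rfl, by rw [← mul_assoc, ← hkx], ?_⟩
      -- `(k x) y = k (x y) = k y x c = y k c x c = y (k x)`
      calc k * x * y = k * (x * y) := mul_assoc _ _ _
        _ = k * (y * x * c) := by rw [hxy]
        _ = (k * y) * x * c := by group
        _ = y * k * c * x * c := by rw [hky]
        _ = y * k * x * (c * c) := by rw [mul_assoc (y * k) c x, hcen x]; group
        _ = y * (k * x) := by rw [hcc]; group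
  obtain ⟨g', hg'eq, hg'x, hg'y⟩ := hfix g hgx
  obtain ⟨h', hh'eq, hh'x, hh'y⟩ := hfix h hhx
  -- `g' h' ≠ h' g'` still (the corrections by `x` commute with `g`, `h`)
  have hne : h' * g' ≠ g' * h' := by
    have key : ∀ (a b : G), a * x = x * a → b * x = x * b → a * b ≠ b * a →
        ∀ a' b' : G, (a' = a ∨ a' = a * x) → (b' = b ∨ b' = b * x) → b' * a' ≠ a' * b' := by
      intro a b hax hbx habne a' b' ha' hb' heq
      apply habne
      rcases ha' with ha' | ha' <;> rcases hb' with hb' | hb' <;> rw [ha', hb'] at heq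
      · exact heq.symm
      · -- `(b x) a = a (b x)` ⟹ `b a x = a b x`
        have e1 : b * x * a = b * a * x := by rw [mul_assoc, ← hax, ← mul_assoc]
        have e2 : a * (b * x) = a * b * x := (mul_assoc _ _ _).symm
        rw [e1, e2] at heq
        exact (mul_right_cancel heq).symm
      · -- `b (a x) = (a x) b` ⟹ `b a x = a b x`
        have e1 : b * (a * x) = b * a * x := (mul_assoc _ _ _).symm
        have e2 : a * x * b = a * b * x := by rw [mul_assoc, ← hbx, ← mul_assoc]
        rw [e1, e2] at heq
        exact (mul_right_cancel heq).symm
      · -- `(b x)(a x) = (a x)(b x)` ⟹ `b a x x = a b x x`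
        have e1 : b * x * (a * x) = b * a * (x * x) := by
          rw [mul_assoc, ← mul_assoc x a x, ← hax, mul_assoc a x x, ← mul_assoc]
        have e2 : a * x * (b * x) = a * b * (x * x) := by
          rw [mul_assoc, ← mul_assoc x b x, ← hbx, mul_assoc b x x, ← mul_assoc]
        rw [e1, e2] at heq
        exact (mul_right_cancel heq).symm
    exact key g h hgx hhx hgh g' h' hg'eq hh'eq
  exact ⟨g', h', hg'x, hg'y, hh'x, hh'y, comm_mul_of_ne hcc hcen hsq hne⟩

/-- **Normalising a non-commuting pair**: from `y x = x y c` one gets a pair `x₁, y₁` in the subgroup generated by `x, y` — namely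
`(x, y)`, `(x, x y)` or `(y, y x)` — with `y₁ x₁ = x₁ y₁ c` and `x₁² = y₁²` (both `1`: dihedral type; both `c`: quaternion type);
elements commuting with `x` and `y` commute with `x₁` and `y₁`. [folklore] -/
theorem exists_noncomm_pair_normalised {c : G} (hcc : c * c = 1) (hcen : ∀ g : G, c * g = g * c)
    (hsq : ∀ g : G, g * g = 1 ∨ g * g = c) {x y : G} (hyx : y * x = x * y * c) :
    ∃ x₁ y₁ : G, y₁ * x₁ = x₁ * y₁ * c ∧ ((x₁ * x₁ = 1 ∧ y₁ * y₁ = 1) ∨ (x₁ * x₁ = c ∧ y₁ * y₁ = c)) ∧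
      ∀ w : G, w * x = x * w → w * y = y * w → w * x₁ = x₁ * w ∧ w * y₁ = y₁ * w := by
  have hxy : x * y = y * x * c := comm_mul_symm hcc hyx
  -- `(x y)² = x² y² c`
  have hxyxy : x * y * (x * y) = (x * x) * (y * y) * c := by
    calc x * y * (x * y) = x * (y * x) * y := by group
      _ = x * (x * y * c) * y := by rw [hyx]
      _ = (x * x) * (y * (c * y)) := by group
      _ = (x * x) * (y * (y * c)) := by rw [hcen y]
      _ = (x * x) * (y * y) * c := by group
  rcases hsq x with hxx | hxx <;> rcases hsq y with hyy | hyy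
  · exact ⟨x, y, hyx, Or.inl ⟨hxx, hyy⟩, fun w hwx hwy => ⟨hwx, hwy⟩⟩
  · -- `x² = 1`, `y² = c`: use `(x, x y)`, `(x y)² = c c = 1`
    refine ⟨x, x * y, ?_, Or.inl ⟨hxx, by rw [hxyxy, hxx, hyy, one_mul, hcc]⟩, fun w hwx hwy => ⟨hwx, ?_⟩⟩
    · -- `(x y) x = x (y x) = x (x y c) = x (x y) c`
      rw [mul_assoc, hyx, ← mul_assoc, ← mul_assoc]
    · rw [← mul_assoc, hwx, mul_assoc, hwy, mul_assoc]
  · -- `x² = c`, `y² = 1`: use `(y, y x)`, `(y x)² = ... = 1`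
    have hyxyx : y * x * (y * x) = 1 := by
      calc y * x * (y * x) = y * (x * y) * x := by group
        _ = y * (y * x * c) * x := by rw [hxy]
        _ = (y * y) * (x * (c * x)) := by group
        _ = (y * y) * (x * (x * c)) := by rw [hcen x]
        _ = (y * y) * (x * x) * c := by group
        _ = 1 := by rw [hyy, hxx, one_mul, hcc]
    refine ⟨y, y * x, ?_, Or.inl ⟨hyy, hyxyx⟩, fun w hwx hwy => ⟨hwy, ?_⟩⟩
    · rw [mul_assoc, hxy, ← mul_assoc, ← mul_assoc]
    · rw [← mul_assoc, hwy, mul_assoc, hwx, mul_assoc]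
  · exact ⟨x, y, hyx, Or.inr ⟨hxx, hyy⟩, fun w hwx hwy => ⟨hwx, hwy⟩⟩


/-! ## §5 Words in a non-commuting pair -/

/-- `c^{(s+t).val} = c^{s.val} c^{t.val}` for an involution `c` and `s, t ∈ 𝔽₂`. [folklore] -/
theorem invol_pow_add {c : G} (hcc : c * c = 1) (s t : ZMod 2) : c ^ (s + t).val = c ^ s.val * c ^ t.val := by
  rw [← pow_add]
  exact pow_eq_pow_of_mod_eq c (n := 2) (by rw [pow_two, hcc]) (by rw [ZMod.val_add]; omega)

/-- Four `𝔽₂`-powers of an involution combine: `c^{s₁} c^{s₂} c^{z} c^{w} = c^{z + w + s₁ + s₂}`. [folklore] -/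
theorem invol_pow_four {c : G} (hcc : c * c = 1) (s₁ s₂ z w : ZMod 2) :
    c ^ s₁.val * (c ^ s₂.val * (c ^ z.val * c ^ w.val)) = c ^ (z + w + s₁ + s₂).val := by
  rw [← pow_add, ← pow_add, ← pow_add]
  exact pow_eq_pow_of_mod_eq c (n := 2) (by rw [pow_two, hcc]) (by rw [ZMod.val_add, ZMod.val_add, ZMod.val_add]; omega)

/-- **Multiplication of the words `xᵃ yᵇ`** (`a, b ∈ 𝔽₂`) for `y x = x y c`, `x² = c^α`, `y² = c^β`, `c` a central involution:
`(xᵃ yᵇ)(xᵉ yᶠ) = x^{a+e} y^{b+f} c^{be + α ae + β bf}`. [folklore] -/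
theorem pair_words_mul {c x y : G} (hcc : c * c = 1) (hcen : ∀ g : G, c * g = g * c) (α β : ZMod 2)
    (hyx : y * x = x * y * c) (hxx : x * x = c ^ α.val) (hyy : y * y = c ^ β.val) (a b e f : ZMod 2) :
    x ^ a.val * y ^ b.val * (x ^ e.val * y ^ f.val) =
      x ^ (a + e).val * y ^ (b + f).val * c ^ (b * e + α * (a * e) + β * (b * f)).val := by
  have hv0 : (0 : ZMod 2).val = 0 := rfl
  have hv1 : (1 : ZMod 2).val = 1 := rfl
  have h11 : ((1 : ZMod 2) + 1).val = 0 := rfl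
  have hαc : ∀ g : G, c ^ α.val * g = g * c ^ α.val := fun g => ((show Commute c g from hcen g).pow_left α.val).eq
  have hβc : ∀ g : G, c ^ β.val * g = g * c ^ β.val := fun g => ((show Commute c g from hcen g).pow_left β.val).eq
  rcases zmod2_cases a with rfl | rfl <;> rcases zmod2_cases b with rfl | rfl <;>
    rcases zmod2_cases e with rfl | rfl <;> rcases zmod2_cases f with rfl | rfl <;>
    simp only [hv0, hv1, h11, pow_zero, pow_one, one_mul, mul_one, mul_zero, add_zero, zero_add]
  · -- `(0,1,0,1)`: `y y = c^β`
    exact hyy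
  · -- `(0,1,1,0)`: `y x = x y c`
    exact hyx
  · -- `(0,1,1,1)`: `y (x y) = x c^{1+β} = x (c · y²)`
    rw [invol_pow_add hcc, hv1, pow_one, ← hyy]
    calc y * (x * y) = (y * x) * y := (mul_assoc _ _ _).symm
      _ = x * y * c * y := by rw [hyx]
      _ = x * (y * (c * y)) := by simp only [mul_assoc]
      _ = x * (y * (y * c)) := by rw [hcen y]
      _ = x * (c * (y * y)) := by rw [← mul_assoc y y c, ← hcen (y * y)]
  · -- `(1,0,1,0)`: `x x = c^α`
    exact hxx
  · -- `(1,0,1,1)`: `x (x y) = y c^α`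
    rw [← mul_assoc, hxx, hαc]
  · -- `(1,1,0,1)`: `(x y) y = x c^β`
    rw [mul_assoc, hyy]
  · -- `(1,1,1,0)`: `(x y) x = y c^{1+α} = y (c · x²)`
    rw [invol_pow_add hcc, hv1, pow_one, ← hxx]
    calc x * y * x = x * (y * x) := mul_assoc _ _ _
      _ = x * (x * y * c) := by rw [hyx]
      _ = (x * x) * (y * c) := by simp only [mul_assoc]
      _ = (x * x) * (c * y) := by rw [hcen y]
      _ = (c * y) * (x * x) := by rw [hxx, hαc]
      _ = y * (c * (x * x)) := by rw [hcen y, mul_assoc]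
  · -- `(1,1,1,1)`: `(x y)(x y) = c^{1+α+β} = c x² y²`
    rw [invol_pow_add hcc, invol_pow_add hcc, hv1, pow_one, ← hxx, ← hyy]
    calc x * y * (x * y) = x * (y * x) * y := by simp only [mul_assoc]
      _ = x * (x * y * c) * y := by rw [hyx]
      _ = (x * x) * (y * (c * y)) := by simp only [mul_assoc]
      _ = (x * x) * (y * (y * c)) := by rw [hcen y]
      _ = (x * x) * (y * y) * c := by simp only [mul_assoc]
      _ = c * (x * x) * (y * y) := by rw [← hcen ((x * x) * (y * y)), ← mul_assoc]

/-! ## §6 The table model on `𝔽₂⁵` -/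

/-- **Recognition of a table from words, with an explicit inverse on the table** (variant of
`GaloisTableLaws.exists_table_equiv_of_words` trading the cancellation hypothesis — cubic in `|X|` to `decide` — for a
left-inverse identity, quadratic in `|X|`): `f : X → G` multiplicative with trivial kernel and `f o = 1`, `mul p o = p`,
`mul (inv p) (mul p q) = q`, `|G| = |X|` ⟹ a table model `e : G ≃ X` with `e (f p) = p`. [folklore] -/
theorem exists_table_equiv_of_words_inv {X : Type*} [Fintype X] [Finite G] (mul : X → X → X) (o : X) (inv : X → X)
    (f : X → G) (hf : ∀ p q : X, f (mul p q) = f p * f q) (hker : ∀ p : X, f p = 1 → p = o) (hfo : f o = 1)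
    (ho : ∀ p : X, mul p o = p) (hlinv : ∀ p q : X, mul (inv p) (mul p q) = q) (hcard : Nat.card G = Fintype.card X) :
    ∃ e : G ≃ X, (∀ a b : G, e (a * b) = mul (e a) (e b)) ∧ ∀ p : X, e (f p) = p := by
  have hio : ∀ p : X, mul (inv p) p = o := fun p => by
    have := hlinv p o
    rwa [ho] at this
  have hii : ∀ p : X, inv (inv p) = p := fun p => by
    have := hlinv (inv p) p
    rwa [hio, ho] at this
  have hinj : Function.Injective f := by
    intro p q hpq
    have h1 : f (mul (inv p) q) = 1 := by rw [hf, ← hpq, ← hf, hio, hfo]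
    have h2 : mul (inv p) q = o := hker _ h1
    have h3 := hlinv (inv p) q
    rw [h2, ho, hii] at h3
    exact h3
  have hbij : Function.Bijective f :=
    hinj.bijective_of_nat_card_le (by rw [hcard, Nat.card_eq_fintype_card])
  refine ⟨(Equiv.ofBijective f hbij).symm, fun a b => ?_, fun p => ?_⟩
  · obtain ⟨p, rfl⟩ := hbij.2 a
    obtain ⟨q, rfl⟩ := hbij.2 b
    rw [← hf]
    simp only [Equiv.ofBijective_symm_apply_apply]
  · simp only [Equiv.ofBijective_symm_apply_apply]

variable [Finite G]

/-- **Table model for the extraspecial configuration.**  `|G| = 32`, `c ≠ 1` a central involution, `x, y, x', y'` with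
`y x = x y c`, `y' x' = x' y' c`, `x', y'` commuting with `x, y`, `x² = c^α`, `y² = c^β`, `x'² = c^{α'}`, `y'² = c^{β'}`;
`mul` an operation on `𝔽₂⁵` agreeing with the law above, with `mul p 0 = p` and the left-inverse identity for the explicit
inverse `(a,b,a',b',z) ↦ (a,b,a',b', z + ab + αa + βb + a'b' + α'a' + β'b')` (both `decide`d at concrete parameters).  Then the word map
`(a,b,a',b',z) ↦ xᵃ yᵇ x'ᵃ' y'ᵇ' cᶻ` inverts to a table model `e : G ≃ 𝔽₂⁵` with `e x = (1,0,0,0,0)`, `e y = (0,1,0,0,0)`,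
`e x' = (0,0,1,0,0)`, `e y' = (0,0,0,1,0)`, `e c = (0,0,0,0,1)`, `e 1 = 0`. [folklore] -/
theorem exists_table_extraspecial {c x y x' y' : G} (hcc : c * c = 1) (hc1 : c ≠ 1) (hcen : ∀ g : G, c * g = g * c)
    (α β α' β' : ZMod 2) (hyx : y * x = x * y * c) (hxx : x * x = c ^ α.val) (hyy : y * y = c ^ β.val)
    (hyx' : y' * x' = x' * y' * c) (hxx' : x' * x' = c ^ α'.val) (hyy' : y' * y' = c ^ β'.val)
    (hx'x : x' * x = x * x') (hx'y : x' * y = y * x') (hy'x : y' * x = x * y') (hy'y : y' * y = y * y')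
    (hcard : Nat.card G = 32)
    (mul : ZMod 2 × ZMod 2 × ZMod 2 × ZMod 2 × ZMod 2 → ZMod 2 × ZMod 2 × ZMod 2 × ZMod 2 × ZMod 2 →
      ZMod 2 × ZMod 2 × ZMod 2 × ZMod 2 × ZMod 2)
    (hm : ∀ p q : ZMod 2 × ZMod 2 × ZMod 2 × ZMod 2 × ZMod 2, mul p q =
      (p.1 + q.1, p.2.1 + q.2.1, p.2.2.1 + q.2.2.1, p.2.2.2.1 + q.2.2.2.1,
        p.2.2.2.2 + q.2.2.2.2 + (p.2.1 * q.1 + α * (p.1 * q.1) + β * (p.2.1 * q.2.1)) +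
          (p.2.2.2.1 * q.2.2.1 + α' * (p.2.2.1 * q.2.2.1) + β' * (p.2.2.2.1 * q.2.2.2.1))))
    (ho : ∀ p : ZMod 2 × ZMod 2 × ZMod 2 × ZMod 2 × ZMod 2, mul p (0, 0, 0, 0, 0) = p)
    (hlinv : ∀ p q : ZMod 2 × ZMod 2 × ZMod 2 × ZMod 2 × ZMod 2,
      mul (p.1, p.2.1, p.2.2.1, p.2.2.2.1, p.2.2.2.2 + p.1 * p.2.1 + α * p.1 + β * p.2.1 + p.2.2.1 * p.2.2.2.1 +
        α' * p.2.2.1 + β' * p.2.2.2.1) (mul p q) = q) :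
    ∃ e : G ≃ ZMod 2 × ZMod 2 × ZMod 2 × ZMod 2 × ZMod 2, (∀ g h : G, e (g * h) = mul (e g) (e h)) ∧
      e x = (1, 0, 0, 0, 0) ∧ e y = (0, 1, 0, 0, 0) ∧ e x' = (0, 0, 1, 0, 0) ∧ e y' = (0, 0, 0, 1, 0) ∧
      e c = (0, 0, 0, 0, 1) ∧ e 1 = (0, 0, 0, 0, 0) := by
  have hv0 : (0 : ZMod 2).val = 0 := rfl
  have hv1 : (1 : ZMod 2).val = 1 := rfl
  -- commuting powers
  have hcg : ∀ (n : ℕ) (g : G), Commute (c ^ n) g := fun n g => (show Commute c g from hcen g).pow_left n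
  have cx'x : ∀ i : ℕ, Commute (x' ^ i) x := fun i => (show Commute x' x from hx'x).pow_left i
  have cx'y : ∀ i : ℕ, Commute (x' ^ i) y := fun i => (show Commute x' y from hx'y).pow_left i
  have cy'x : ∀ i : ℕ, Commute (y' ^ i) x := fun i => (show Commute y' x from hy'x).pow_left i
  have cy'y : ∀ i : ℕ, Commute (y' ^ i) y := fun i => (show Commute y' y from hy'y).pow_left i
  have hX'x : ∀ i j : ℕ, Commute (x' ^ i) (x ^ j) := fun i j => ((show Commute x' x from hx'x).pow_pow i j)
  have hX'y : ∀ i j : ℕ, Commute (x' ^ i) (y ^ j) := fun i j => ((show Commute x' y from hx'y).pow_pow i j)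
  have hY'x : ∀ i j : ℕ, Commute (y' ^ i) (x ^ j) := fun i j => ((show Commute y' x from hy'x).pow_pow i j)
  have hY'y : ∀ i j : ℕ, Commute (y' ^ i) (y ^ j) := fun i j => ((show Commute y' y from hy'y).pow_pow i j)
  -- pair laws with a tail
  have pairR : ∀ (a b e f : ZMod 2) (R : G), x ^ a.val * (y ^ b.val * (x ^ e.val * (y ^ f.val * R))) =
      x ^ (a + e).val * (y ^ (b + f).val * (c ^ (b * e + α * (a * e) + β * (b * f)).val * R)) := by
    intro a b e f R
    rw [show x ^ a.val * (y ^ b.val * (x ^ e.val * (y ^ f.val * R))) = (x ^ a.val * y ^ b.val * (x ^ e.val * y ^ f.val)) * R by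
      simp only [mul_assoc], pair_words_mul hcc hcen α β hyx hxx hyy a b e f]
    simp only [mul_assoc]
  have pairR' : ∀ (a b e f : ZMod 2) (R : G), x' ^ a.val * (y' ^ b.val * (x' ^ e.val * (y' ^ f.val * R))) =
      x' ^ (a + e).val * (y' ^ (b + f).val * (c ^ (b * e + α' * (a * e) + β' * (b * f)).val * R)) := by
    intro a b e f R
    rw [show x' ^ a.val * (y' ^ b.val * (x' ^ e.val * (y' ^ f.val * R))) =
        (x' ^ a.val * y' ^ b.val * (x' ^ e.val * y' ^ f.val)) * R by simp only [mul_assoc],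
      pair_words_mul hcc hcen α' β' hyx' hxx' hyy' a b e f]
    simp only [mul_assoc]
  set f : ZMod 2 × ZMod 2 × ZMod 2 × ZMod 2 × ZMod 2 → G :=
    fun p => x ^ p.1.val * y ^ p.2.1.val * x' ^ p.2.2.1.val * y' ^ p.2.2.2.1.val * c ^ p.2.2.2.2.val with hf_def
  have hf : ∀ p q, f (mul p q) = f p * f q := by
    rintro ⟨a, b, a', b', z⟩ ⟨e, f', e', f'', w⟩
    rw [hm]
    simp only [hf_def, mul_assoc]
    symm
    -- move `c^z` to the end, then `x'^{a'}`, `y'^{b'}` past `x^e`, `y^{f'}`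
    rw [(hcg z.val (x ^ e.val)).left_comm, (hcg z.val (y ^ f'.val)).left_comm, (hcg z.val (x' ^ e'.val)).left_comm,
      (hcg z.val (y' ^ f''.val)).left_comm, (hY'x b'.val e.val).left_comm, (hY'y b'.val f'.val).left_comm,
      (hX'x a'.val e.val).left_comm, (hX'y a'.val f'.val).left_comm, pairR, pairR',
      (hcg _ (x' ^ (a' + e').val)).left_comm, (hcg _ (y' ^ (b' + f'').val)).left_comm, invol_pow_four hcc]
  have hker : ∀ p, f p = 1 → p = (0, 0, 0, 0, 0) := by
    rintro ⟨a, b, a', b', z⟩ h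
    simp only [hf_def] at h
    -- a commutator trick: `u (v R) = (v R) u` with `R` commuting with `u` and `v u = u v c` forces `c = 1`
    have trick : ∀ (u v R : G), v * u = u * v * c → R * u = u * R → v * R = 1 → False := by
      intro u v R hvu hRu hvR
      apply hc1
      have h1 : u = u * c := by
        calc u = v * R * u := by rw [hvR, one_mul]
          _ = v * (u * R) := by rw [mul_assoc, hRu]
          _ = u * v * c * R := by rw [← mul_assoc, hvu]
          _ = u * (v * R) * c := by rw [mul_assoc (u * v), hcen R, ← mul_assoc, mul_assoc u]
          _ = u * c := by rw [hvR, mul_one]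
      exact (mul_left_cancel (a := u) ((mul_one u).trans h1)).symm
    -- `a = 0` (test against `y`)
    have ha : a = 0 := by
      rcases zmod2_cases a with rfl | rfl
      · rfl
      exfalso
      rw [hv1, pow_one] at h
      refine trick y x (y ^ b.val * x' ^ a'.val * y' ^ b'.val * c ^ z.val) (comm_mul_symm hcc hyx) ?_ (by simpa only [mul_assoc] using h)
      have h2 : Commute (y ^ b.val * x' ^ a'.val * y' ^ b'.val * c ^ z.val) y :=
        ((((Commute.refl y).pow_left _).mul_left (cx'y _)).mul_left (cy'y _)).mul_left (hcg _ y)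
      exact h2.eq
    subst ha
    rw [hv0, pow_zero, one_mul] at h
    -- `b = 0` (test against `x`)
    have hb : b = 0 := by
      rcases zmod2_cases b with rfl | rfl
      · rfl
      exfalso
      rw [hv1, pow_one] at h
      refine trick x y (x' ^ a'.val * y' ^ b'.val * c ^ z.val) hyx ?_ (by simpa only [mul_assoc] using h)
      have h2 : Commute (x' ^ a'.val * y' ^ b'.val * c ^ z.val) x := ((cx'x _).mul_left (cy'x _)).mul_left (hcg _ x)
      exact h2.eq
    subst hb
    rw [hv0, pow_zero, one_mul] at h
    -- `a' = 0` (test against `y'`)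
    have ha' : a' = 0 := by
      rcases zmod2_cases a' with rfl | rfl
      · rfl
      exfalso
      rw [hv1, pow_one] at h
      refine trick y' x' (y' ^ b'.val * c ^ z.val) (comm_mul_symm hcc hyx') ?_ (by simpa only [mul_assoc] using h)
      exact (((Commute.refl y').pow_left _).mul_left (hcg _ y')).eq
    subst ha'
    rw [hv0, pow_zero, one_mul] at h
    -- `b' = 0` (test against `x'`)
    have hb' : b' = 0 := by
      rcases zmod2_cases b' with rfl | rfl
      · rfl
      exfalso
      rw [hv1, pow_one] at h
      refine trick x' y' (c ^ z.val) hyx' (hcg _ x').eq (by simpa only [mul_assoc] using h)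
    subst hb'
    rw [hv0, pow_zero, one_mul] at h
    -- `z = 0`
    rcases zmod2_cases z with rfl | rfl
    · rfl
    · rw [hv1, pow_one] at h
      exact absurd h hc1
  have hfo : f (0, 0, 0, 0, 0) = 1 := by simp only [hf_def, hv0, pow_zero, mul_one]
  obtain ⟨e, he, hef⟩ := exists_table_equiv_of_words_inv mul (0, 0, 0, 0, 0) _ f hf hker hfo ho hlinv
    (by rw [hcard]; simp [ZMod.card])
  refine ⟨e, he, ?_, ?_, ?_, ?_, ?_, ?_⟩
  · have h := hef (1, 0, 0, 0, 0)
    simp only [hf_def, hv0, hv1, pow_zero, pow_one, mul_one] at h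
    exact h
  · have h := hef (0, 1, 0, 0, 0)
    simp only [hf_def, hv0, hv1, pow_zero, pow_one, mul_one, one_mul] at h
    exact h
  · have h := hef (0, 0, 1, 0, 0)
    simp only [hf_def, hv0, hv1, pow_zero, pow_one, mul_one, one_mul] at h
    exact h
  · have h := hef (0, 0, 0, 1, 0)
    simp only [hf_def, hv0, hv1, pow_zero, pow_one, mul_one, one_mul] at h
    exact h
  · have h := hef (0, 0, 0, 0, 1)
    simp only [hf_def, hv0, hv1, pow_zero, pow_one, mul_one, one_mul] at h
    exact h
  · have h := hef (0, 0, 0, 0, 0)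
    simp only [hf_def, hv0, pow_zero, mul_one] at h
    exact h

end Summit.HodgeConjecture.CorCM.GaloisModels.FrattiniTwo
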